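import Summits.QuantumAdvantage.QuantumAdvantage.Theorems.CubicForrelationNearExactIsExactSixteenDigits
import Summits.QuantumAdvantage.QuantumAdvantage.Theorems.CubicForrelationNearExactIsExactSaturatedTilings
import Summits.QuantumAdvantage.QuantumAdvantage.Theorems.CubicForrelationNearExactIsExactRothausB

/-!
# Crux `CubicForrelation.NearExactIsExact` (stmt-QuantumAdvantage-14043) — type-O cubics on 18 bits have Walsh capacity at most
  `63/64`

Certificate seat `b2b-cforr-cert` (gen 3; rung `θ₁₈ ≤ 63/64`).  HONEST FRAMING: a theorem about cubic Boolean functions on 18 bits —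
a finite-slice verdict toward the `θ_n` ladder, NOT summit progress.

For a cubic `g : 𝔽₂¹⁸ → 𝔽₂`, `W_g = 64u` (Ax, `⌈18/3⌉ = 6`) and the parity `[u odd]` is CONSTANT (the 2-adic tower at level 6 with
`d = 0`): `g` is "type O" (every `u(x)` odd, `ei_typeO_of_exists_odd`) or every `u(x)` is even.  For type O the landed tower only
gives the capacity bound `127/128`.  THEOREM `ei_typeO_capacity`: **every type-O cubic `g` on 18 bits has
`Σ_x |W_g(x)| ≤ (63/64)·2²⁷`.**

Proof (the `n = 12` argument of `Negative/NoCaseATwelve.lean` six bits up, through the generic tiling lemmas of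
`…SaturatedTilings.lean`).  DIGITS (`ei_digitOne`, `ei_digitTwo`): with `u` odd, `d₁ = [⌊u/2⌋ odd]` is AFFINE and
`d₂ = [⌊u/4⌋ odd]` is CUBIC (Poisson over `E_I` + Ax on `E_{Iᶜ}`: `Σ_{E_I} u ≡ 0 (mod 4)` for `|I| ≥ 2`, `(mod 8)` for `|I| ≥ 4`).
POINTWISE (`ei_pt`): for odd `v`, `16|v| ≤ v² + 63 − 8·[d₁ ≠ d₂]` (`d₁ ≠ d₂ ⟺ v ≡ ±3 (mod 8)`).  PARSEVAL: `Σ u² = 2²⁴`.  Hence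
`16·Σ|u| ≤ 127·2¹⁸ − 8·#A` with `A = supp(d₁ ⊕ d₂)` of degree `≤ 3`, so `#A ≥ 2¹⁵` (Reed–Muller) as soon as `A ≠ ∅`, giving
`126·2¹⁸`, i.e. `63/64`.  NO CASE A (`ei_no_caseA`): `A = ∅` is impossible — `18 = 3·6`, so `u(0) ≡ N₆ (mod 2)` (the number of tilings
of the 18 variables by 6 cubic monomials of `g`) is odd; the perfect-matching recursion gives a monomial `s₀ ∋ 0` with support `T`,
`|T| = 3`, and `N₅(Tᶜ)` odd, whence `Σ_{E_T} u ≡ 4 (mod 8)` by Poisson; but `u ≡ 1 + 6d₁ (mod 8)` with `d₁` affine gives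
`Σ_{E_T} u ≡ 8 + 6·{0,4,8} ≡ 0 (mod 8)`.

References: J. Ax (1964) / R. J. McEliece (1972) (Carlet 2021 §4.1); MacWilliams–Sloane Ch. 13–15; R. O'Donnell, *Analysis of
Boolean Functions* (2014) §1.4.  Everything below is proved from Mathlib and the tree; axioms are the standard three.
-/

set_option linter.dupNamespace false -- D-0017: single-problem summit ⇒ `QuantumAdvantage.QuantumAdvantage` by design

noncomputable section

namespace Summit.QuantumAdvantage.QuantumAdvantage.Theorems.CubicForrelation.NearExactIsExact

open Finset
open Literature.Computability.QuantumComplexity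
open Literature.Computability.QuantumComplexity.BuzetChailloux (zeroVec)
open Literature.Computability.QuantumComplexity.DerivativeWalsh (W)

section Eighteen

variable (g : (Fin (9 + 9) → Bool) → Bool) (u : (Fin (9 + 9) → Bool) → ℤ)

/-! ### Cube sums, the type-O dichotomy and the digits on 18 bits -/

/-- The cube sums of `u = W_g/64` for a cubic `g` on 18 bits: `64·Σ_{E_I} u = 2^{|I|}·2^{⌈(18−|I|)/3⌉}·z` (Poisson over `E_I`,
Ax on `E_{Iᶜ}`). [cite: Carlet2020, §4.1] -/
theorem ei_cube_sum (hg : IsDegLeFun 3 g) (hu : ∀ x, W (fun y => signOf (g y)) x = (2 : ℝ) ^ 6 * (u x : ℝ))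
    (I : Finset (Fin (9 + 9))) :
    ∃ z : ℤ, (2 : ℤ) ^ 6 * ∑ x ∈ {x : Fin (9 + 9) → Bool | ∀ i, x i = true → i ∈ I}, u x =
      2 ^ #I * (2 ^ ((9 + 9 - #I + 2) / 3) * z) := by
  have hP := bb_poisson (fun y => signOf (g y)) I
  obtain ⟨z, hz⟩ := stub_axParity (9 + 9) 3 g Iᶜ (by norm_num) hg
  have hj : #Iᶜ = 9 + 9 - #I := by rw [card_compl, Fintype.card_fin]
  rw [hj, show (9 + 9 - #I + 3 - 1) / 3 = (9 + 9 - #I + 2) / 3 by omega] at hz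
  rw [sum_congr rfl fun x _ => hu x, ← mul_sum, hz] at hP
  refine ⟨z, ?_⟩
  have h' : (((2 : ℤ) ^ 6 * ∑ x ∈ {x : Fin (9 + 9) → Bool | ∀ i, x i = true → i ∈ I}, u x : ℤ) : ℝ) =
      (((2 : ℤ) ^ #I * (2 ^ ((9 + 9 - #I + 2) / 3) * z) : ℤ) : ℝ) := by
    push_cast at hP ⊢
    linarith
  exact_mod_cast h'

/-- **Type O is all-or-nothing on 18 bits.** For cubic `g` on 18 bits with `W_g = 64u`: one odd `u(x)` forces all `u(x)` odd
(the level-6 parity has degree `≤ 0` by the tower, and a non-zero degree-0 function is everywhere `1`). [this work] -/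
theorem ei_typeO_of_exists_odd (hg : IsDegLeFun 3 g) (hu : ∀ x, W (fun y => signOf (g y)) x = (2 : ℝ) ^ 6 * (u x : ℝ))
    (h : ∃ x, Odd (u x)) : ∀ x, Odd (u x) := by
  have hdeg := stub_walshTower stub_axParity (9 + 9) 6 0 g u hg hu (by intro k hk hkn; omega)
  obtain ⟨x₀, hx₀⟩ := h
  have hrm := bb_rmWeight_holds (9 + 9) 0 _ hdeg ⟨x₀, decide_eq_true hx₀⟩
  intro x
  by_contra hx
  have hlt : #(univ.filter fun x => decide (Odd (u x)) = true) < 2 ^ (9 + 9) := by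
    calc #(univ.filter fun x => decide (Odd (u x)) = true) < #(univ : Finset (Fin (9 + 9) → Bool)) := by
          apply card_lt_card
          refine (ssubset_iff_of_subset (filter_subset _ _)).2 ⟨x, mem_univ _, ?_⟩
          simp [hx]
      _ = 2 ^ (9 + 9) := by rw [card_univ, Fintype.card_fun, Fintype.card_bool, Fintype.card_fin]
  omega

/-- For type O the odd points of a cube are all of it: `#{x ∈ E_I : u odd} = 2^{|I|}`. -/
theorem ei_card_odd_cube (hodd : ∀ x, Odd (u x)) (I : Finset (Fin (9 + 9))) :
    (#(({x : Fin (9 + 9) → Bool | ∀ i, x i = true → i ∈ I} : Finset _).filter fun x => Odd (u x)) : ℤ) = 2 ^ #I := by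
  rw [filter_true_of_mem fun x _ => hodd x, bb_card_cube]
  push_cast
  rfl

/-- **Digit one (type O, 18 bits).** If every `u(x)` is odd then `x ↦ [⌊u(x)/2⌋ odd]` is AFFINE (degree `≤ 1`): for `|I| ≥ 2`,
`Σ_{E_I} u ≡ 0 (mod 4)` and `Σ_{E_I} u = 2·Σ⌊u/2⌋ + 2^{|I|}`. [this work; cite: Carlet2020, §4.1 (McEliece)] -/
theorem ei_digitOne (hg : IsDegLeFun 3 g) (hu : ∀ x, W (fun y => signOf (g y)) x = (2 : ℝ) ^ 6 * (u x : ℝ))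
    (hodd : ∀ x, Odd (u x)) : IsDegLeFun 1 (fun x => decide (Odd (u x / 2))) := by
  refine bb_moebius_isDegLeFun 1 _ fun I hI => ?_
  have hk : #I ≤ 9 + 9 := (card_le_univ I).trans_eq (Fintype.card_fin _)
  obtain ⟨z, hz⟩ := ei_cube_sum g u hg hu I
  have h4 : (2 : ℤ) ^ 2 ∣ ∑ x ∈ {x : Fin (9 + 9) → Bool | ∀ i, x i = true → i ∈ I}, u x :=
    sx_dvd_of_balance (by omega) hz
  have hsplit : ∑ x ∈ {x : Fin (9 + 9) → Bool | ∀ i, x i = true → i ∈ I}, u x =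
      2 * ∑ x ∈ {x : Fin (9 + 9) → Bool | ∀ i, x i = true → i ∈ I}, u x / 2 + 2 ^ #I := by
    rw [sum_congr rfl fun x _ => td_two_mul_div_add (u x), sum_add_distrib, ← mul_sum, td_sum_ite_odd,
      ei_card_odd_cube u hodd I]
  obtain ⟨e, he⟩ : ∃ e, #I = e + 2 := ⟨#I - 2, by omega⟩
  have hE : Even (∑ x ∈ {x : Fin (9 + 9) → Bool | ∀ i, x i = true → i ∈ I}, u x / 2) := by
    rw [pow_two] at h4
    obtain ⟨q, hq⟩ := h4
    rw [he, pow_add] at hsplit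
    refine ⟨q - 2 ^ e, ?_⟩
    nlinarith
  have hE' := (tw_even_sum_iff _ (fun x => u x / 2)).1 hE
  rw [filter_filter] at hE'
  simpa only [decide_eq_true_eq] using hE'

/-- **Digit two (type O, 18 bits).** If every `u(x)` is odd then `x ↦ [⌊⌊u(x)/2⌋/2⌋ odd]` is CUBIC (degree `≤ 3`): for `|I| ≥ 4`,
`Σ_{E_I} u ≡ 0 (mod 8)`, `Σ_{E_I} u = 4·Σ⌊u/4⌋ + 2·#{d₁} + 2^{|I|}` and `#{d₁ on E_I} ∈ {0, 2^{|I|−1}, 2^{|I|}}`. [this work] -/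
theorem ei_digitTwo (hg : IsDegLeFun 3 g) (hu : ∀ x, W (fun y => signOf (g y)) x = (2 : ℝ) ^ 6 * (u x : ℝ))
    (hodd : ∀ x, Odd (u x)) : IsDegLeFun 3 (fun x => decide (Odd (u x / 2 / 2))) := by
  have hP1 := ei_digitOne g u hg hu hodd
  refine bb_moebius_isDegLeFun 3 _ fun I hI => ?_
  have hk : #I ≤ 9 + 9 := (card_le_univ I).trans_eq (Fintype.card_fin _)
  obtain ⟨z, hz⟩ := ei_cube_sum g u hg hu I
  have h8 : (2 : ℤ) ^ 3 ∣ ∑ x ∈ {x : Fin (9 + 9) → Bool | ∀ i, x i = true → i ∈ I}, u x :=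
    sx_dvd_of_balance (by omega) hz
  obtain ⟨z'', hz''⟩ := td_count_cube (le_refl 1) (fun x => decide (Odd (u x / 2))) hP1 I
  rw [show (#I + 1 - 1) / 1 = #I by simp] at hz''
  have hB : (4 : ℤ) ∣ #{x : Fin (9 + 9) → Bool | (∀ i, x i = true → i ∈ I) ∧ decide (Odd (u x / 2)) = true} := by
    obtain ⟨e, he⟩ : ∃ e, #I = e + 4 := ⟨#I - 4, by omega⟩
    rw [he, show (2 : ℤ) ^ (e + 4) = 2 ^ e * 16 by rw [pow_add]; norm_num] at hz''
    refine ⟨2 ^ e * 2 * (1 - z''), ?_⟩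
    linarith
  have hsplit : ∑ x ∈ {x : Fin (9 + 9) → Bool | ∀ i, x i = true → i ∈ I}, u x =
      2 * (2 * ∑ x ∈ {x : Fin (9 + 9) → Bool | ∀ i, x i = true → i ∈ I}, u x / 2 / 2 +
        #{x : Fin (9 + 9) → Bool | (∀ i, x i = true → i ∈ I) ∧ decide (Odd (u x / 2)) = true}) + 2 ^ #I := by
    rw [sum_congr rfl fun x _ => td_two_mul_div_add (u x), sum_add_distrib, ← mul_sum, td_sum_ite_odd,
      ei_card_odd_cube u hodd I, sum_congr rfl fun x _ => td_two_mul_div_add (u x / 2), sum_add_distrib, ← mul_sum,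
      td_sum_ite_odd, filter_filter]
    simp only [decide_eq_true_eq]
  obtain ⟨e, he⟩ : ∃ e, #I = e + 3 := ⟨#I - 3, by omega⟩
  have hE : Even (∑ x ∈ {x : Fin (9 + 9) → Bool | ∀ i, x i = true → i ∈ I}, u x / 2 / 2) := by
    obtain ⟨q, hq⟩ := h8
    obtain ⟨b, hb⟩ := hB
    rw [hq, hb, he, pow_add] at hsplit
    refine ⟨q - b - 2 ^ e, ?_⟩
    nlinarith
  have hE' := (tw_even_sum_iff _ (fun x => u x / 2 / 2)).1 hE
  rw [filter_filter] at hE'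
  simpa only [decide_eq_true_eq] using hE'

/-- Parseval at level 6 on 18 bits: `W_g = 64u ⇒ Σ_x u(x)² = 2^{24}`. [folklore] -/
theorem ei_sum_u_sq (hu : ∀ x, W (fun y => signOf (g y)) x = (2 : ℝ) ^ 6 * (u x : ℝ)) : ∑ x, u x ^ 2 = 2 ^ 24 := by
  have hP := DerivativeWalsh.sum_W_sq (fun y => signOf (g y))
  have h1 : ∀ b : Bool, signOf b ^ 2 = (1 : ℝ) := fun b => by unfold signOf; split_ifs <;> norm_num
  have hL : ∑ x, W (fun y => signOf (g y)) x ^ 2 = (2 : ℝ) ^ 12 * ∑ x, (u x : ℝ) ^ 2 := by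
    rw [mul_sum]
    exact sum_congr rfl fun x _ => by rw [hu x]; ring
  rw [hL, sum_congr rfl fun y _ => h1 _, sum_const, card_univ, Fintype.card_fun, Fintype.card_bool,
    Fintype.card_fin] at hP
  norm_num at hP
  have h2 : ∑ x, (u x : ℝ) ^ 2 = 2 ^ 24 := by linarith
  exact_mod_cast h2

/-! ### No case A on 18 bits: the digits `d₁, d₂` differ somewhere -/

/-- The bias sum of `g` over a coordinate cube through a representing polynomial. [folklore] -/
theorem ei_bias_poly (p : MvPolynomial (Fin (9 + 9)) (ZMod 2)) (hrep : ∀ x, g x = polyPhase p x) (K : Finset (Fin (9 + 9))) :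
    ∑ y ∈ {x : Fin (9 + 9) → Bool | ∀ i, x i = true → i ∈ K}, signOf (g y) =
      ((∑ y ∈ {x : Fin (9 + 9) → Bool | ∀ i, x i = true → i ∈ K},
        ∏ s ∈ p.support, (if (∀ j ∈ s.support, y j = true) then (-1 : ℤ) else 1) : ℤ) : ℝ) := by
  rw [Int.cast_sum]
  exact sum_congr rfl fun x _ => by rw [hrep x, ax_signOf_polyPhase]

/-- **No case A on 18 bits.** No cubic `g : 𝔽₂¹⁸ → 𝔽₂` of type O has `[⌊u/2⌋ odd] = [⌊u/4⌋ odd]` everywhere (i.e. every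
`W_g(x)/64 ≡ ±1 (mod 8)`): `u(0) ≡ N₆ (mod 2)` is odd, the recursion through the pivot `0` yields a monomial `s₀ ∋ 0` with
support `T`, `|T| = 3`, `N₅(Tᶜ)` odd, so `Σ_{E_T} u ≡ 4 (mod 8)`; but `u ≡ 1 + 6d₁ (mod 8)` with `d₁` affine gives `0 (mod 8)`.
[this work] -/
theorem ei_no_caseA (hg : IsDegLeFun 3 g) (hu : ∀ x, W (fun y => signOf (g y)) x = (2 : ℝ) ^ 6 * (u x : ℝ))
    (hodd : ∀ x, Odd (u x)) (hA : ∀ x, Odd (u x / 2) ↔ Odd (u x / 2 / 2)) : False := by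
  obtain ⟨p, hp, hrep⟩ := id hg
  -- (1) `u(0) = N₆ + 2k`, so `N₆` is odd
  have hE0 : #({x : Fin (9 + 9) → Bool | ∀ i, x i = true → i ∈ (∅ : Finset (Fin (9 + 9)))} : Finset _) = 1 := by
    rw [bb_card_cube, card_empty, pow_zero]
  obtain ⟨a, ha⟩ := card_eq_one.1 hE0
  have h0 := bb_poisson (fun y => signOf (g y)) (∅ : Finset (Fin (9 + 9)))
  rw [ha, sum_singleton, card_empty, pow_zero, one_mul, compl_empty, hu a, ei_bias_poly g p hrep univ] at h0
  obtain ⟨k₆, hk₆⟩ := st_cube_bias_congr p hp univ (5 + 1) (by rw [card_univ, Fintype.card_fin])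
  rw [hk₆] at h0
  have h0z : (2 : ℤ) ^ 6 * u a = (-2) ^ (5 + 1) *
      (#{S ∈ p.support.powerset | #S = 5 + 1 ∧ (S.biUnion fun s => s.support) = univ} : ℕ) + 2 ^ (5 + 1 + 1) * k₆ := by
    exact_mod_cast h0
  have hN6 : ¬ Even #{S ∈ p.support.powerset | #S = 5 + 1 ∧ (S.biUnion fun s => s.support) = univ} := by
    rintro ⟨r, hr⟩
    have hua := Int.odd_iff.1 (hodd a)
    rw [hr] at h0z
    push_cast at h0z
    omega
  -- (2) some monomial `s₀ ∋ 0` with `|supp s₀| = 3` has `N₅(univ ∖ supp s₀)` odd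
  have hex : ∃ s₀ ∈ p.support, (0 : Fin (9 + 9)) ∈ s₀.support ∧ #s₀.support = 3 ∧
      ¬ Even #{S' ∈ p.support.powerset | #S' = 5 ∧ (S'.biUnion fun s => s.support) = univ \ s₀.support} := by
    by_contra hall
    push Not at hall
    exact hN6 (st_even_saturated_succ p hp univ 0 (mem_univ _) 5 (by rw [card_univ, Fintype.card_fin])
      fun s₀ hs₀ h0 _ h3 => hall s₀ hs₀ h0 h3)
  obtain ⟨s₀, hs₀p, -, hT3, hodd5⟩ := hex
  set T := s₀.support with hT
  -- (3) Poisson over `E_T`: `Σ_{E_T} u = -4·N₅ + 8k`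
  have h1 := bb_poisson (fun y => signOf (g y)) T
  rw [sum_congr rfl fun x _ => hu x, ← mul_sum, hT3, compl_eq_univ_sdiff, ei_bias_poly g p hrep (univ \ T)] at h1
  obtain ⟨k₅, hk₅⟩ := st_cube_bias_congr p hp (univ \ T) 5
    (by rw [card_sdiff_of_subset (subset_univ _), card_univ, Fintype.card_fin, hT3])
  rw [hk₅] at h1
  have h1z : (2 : ℤ) ^ 6 * ∑ x ∈ {x : Fin (9 + 9) → Bool | ∀ i, x i = true → i ∈ T}, u x =
      2 ^ 3 * ((-2) ^ 5 * (#{S' ∈ p.support.powerset | #S' = 5 ∧ (S'.biUnion fun s => s.support) = univ \ T} : ℕ) +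
        2 ^ (5 + 1) * k₅) := by
    exact_mod_cast h1
  obtain ⟨j, hj⟩ := Nat.not_even_iff_odd.1 hodd5
  rw [hj] at h1z
  push_cast at h1z
  -- (4) digits on `E_T`: `u = 8q + 1 + 6·[d₁]`, and `#{d₁ on E_T} = 4 − 4z'`
  have hpt : ∀ x, u x = 8 * (u x / 2 / 2 / 2) + 1 + 6 * (if Odd (u x / 2) then 1 else 0) := by
    intro x
    have e0 := td_two_mul_div_add (u x)
    have e1 := td_two_mul_div_add (u x / 2)
    have e2 := td_two_mul_div_add (u x / 2 / 2)
    rw [if_pos (hodd x)] at e0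
    by_cases h1 : Odd (u x / 2)
    · rw [if_pos h1] at e1 ⊢
      rw [if_pos ((hA x).1 h1)] at e2
      omega
    · rw [if_neg h1] at e1 ⊢
      rw [if_neg (fun h => h1 ((hA x).2 h))] at e2
      omega
  obtain ⟨z', hz'⟩ := td_count_cube (le_refl 1) (fun x => decide (Odd (u x / 2))) (ei_digitOne g u hg hu hodd) T
  rw [hT3, show (3 + 1 - 1) / 1 = 3 by norm_num] at hz'
  have hET : ((#({x : Fin (9 + 9) → Bool | ∀ i, x i = true → i ∈ T} : Finset _) : ℕ) : ℤ) = 8 := by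
    rw [bb_card_cube T, hT3]
    norm_num
  have hsumT : ∑ x ∈ {x : Fin (9 + 9) → Bool | ∀ i, x i = true → i ∈ T}, u x =
      8 * ∑ x ∈ {x : Fin (9 + 9) → Bool | ∀ i, x i = true → i ∈ T}, (u x / 2 / 2 / 2) + 8 +
        6 * #{x : Fin (9 + 9) → Bool | (∀ i, x i = true → i ∈ T) ∧ decide (Odd (u x / 2)) = true} := by
    rw [sum_congr rfl fun x _ => hpt x, sum_add_distrib, sum_add_distrib, ← mul_sum, ← mul_sum, sum_const, nsmul_eq_mul,
      mul_one, hET, td_sum_ite_odd, filter_filter]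
    simp only [decide_eq_true_eq]
  rw [hsumT] at h1z
  omega

/-! ### The type-O capacity theorem on 18 bits -/

/-- **The pointwise inequality behind `63/64`.** For odd `v`: `16|v| ≤ v² + 63 − 8·[d₁ ≠ d₂]` (`d₁ = [⌊v/2⌋ odd]`,
`d₂ = [⌊v/4⌋ odd]`; `d₁ ≠ d₂ ⟺ v ≡ ±3 (mod 8)`, and then `(|v|−5)(|v|−11) ≥ 0`; otherwise `(|v|−7)(|v|−9) ≥ 0`). [this work] -/
theorem ei_pt (v : ℤ) (hv : Odd v) :
    16 * |v| ≤ v ^ 2 + 63 - 8 * (if ¬ (Odd (v / 2) ↔ Odd (v / 2 / 2)) then 1 else 0) := by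
  rcases le_or_gt 16 |v| with h16 | h16
  · have hsq : 16 * |v| ≤ v ^ 2 := by nlinarith [abs_nonneg v, sq_abs v, abs_mul_abs_self v]
    have hconst : (0 : ℤ) ≤ 63 - 8 * (if ¬ (Odd (v / 2) ↔ Odd (v / 2 / 2)) then 1 else 0) := by
      split_ifs <;> norm_num
    linarith
  · have h1 : -15 ≤ v := by have := (abs_lt.1 h16).1; omega
    have h2 : v ≤ 15 := by have := (abs_lt.1 h16).2; omega
    interval_cases v <;> (try (exfalso; norm_num [Int.odd_iff] at hv; done)) <;> norm_num [Int.odd_iff]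

/-- **Type-O capacity on 18 bits is at most `63/64`.** For cubic `g : 𝔽₂¹⁸ → 𝔽₂` with `W_g = 64u` and every `u(x)` odd,
`Σ_x |W_g(x)| ≤ (63/64)·2²⁷` (the tower alone gives `127/128`): Parseval + `ei_pt` give `16Σ|u| ≤ 127·2¹⁸ − 8#A` with
`A = supp(d₁ ⊕ d₂)` of degree `≤ 3`, non-empty by `ei_no_caseA`, hence of size `≥ 2¹⁵` (Reed–Muller). [this work] -/
theorem ei_typeO_capacity (hg : IsDegLeFun 3 g) (hu : ∀ x, W (fun y => signOf (g y)) x = (2 : ℝ) ^ 6 * (u x : ℝ))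
    (hodd : ∀ x, Odd (u x)) :
    ∑ x, |W (fun y => signOf (g y)) x| ≤ (2 : ℝ) ^ (3 * 9) * (63 / 64) := by
  have hpar := ei_sum_u_sq g u hu
  -- summing the pointwise inequality
  have h := sum_le_sum fun x (_ : x ∈ (univ : Finset (Fin (9 + 9) → Bool))) => ei_pt (u x) (hodd x)
  rw [← mul_sum] at h
  simp only [sum_sub_distrib, sum_add_distrib, ← mul_sum, sum_boole, sum_const, card_univ, Fintype.card_fun,
    Fintype.card_bool, Fintype.card_fin] at h
  rw [hpar] at h
  norm_num at h
  -- the set `A = {d₁ ≠ d₂}` has at least `2^15` points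
  set A := univ.filter fun x : Fin (9 + 9) → Bool => ¬ (Odd (u x / 2) ↔ Odd (u x / 2 / 2)) with hAdef
  have hdeg : IsDegLeFun 3 (fun x => decide (Odd (u x / 2)) ^^ decide (Odd (u x / 2 / 2))) :=
    bb_isDegLeFun_bxor ((ei_digitOne g u hg hu hodd).mono (by norm_num)) (ei_digitTwo g u hg hu hodd)
  have hset : (univ.filter fun x : Fin (9 + 9) → Bool =>
      (decide (Odd (u x / 2)) ^^ decide (Odd (u x / 2 / 2))) = true) = A := by
    rw [hAdef]
    apply filter_congr
    intro x _
    by_cases h1 : Odd (u x / 2) <;> by_cases h2 : Odd (u x / 2 / 2) <;> simp [h1, h2]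
  have hne : ∃ x, (decide (Odd (u x / 2)) ^^ decide (Odd (u x / 2 / 2))) = true := by
    by_contra hnone
    push Not at hnone
    refine ei_no_caseA g u hg hu hodd fun x => ?_
    have hx := hnone x
    by_cases h1 : Odd (u x / 2) <;> by_cases h2 : Odd (u x / 2 / 2) <;> simp [h1, h2] at hx ⊢
  have hrm := bb_rmWeight_holds (9 + 9) 3 _ hdeg hne
  rw [hset] at hrm
  have hA : (2 : ℤ) ^ (9 + 9) ≤ 2 ^ 3 * (#A : ℤ) := by exact_mod_cast hrm
  norm_num at hA
  have hS : 16 * ∑ x, |u x| ≤ 126 * 2 ^ 18 := by linarith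
  have hSR : (16 : ℝ) * ∑ x, |(u x : ℝ)| ≤ 126 * 2 ^ 18 := by
    have h' : (((16 * ∑ x, |u x| : ℤ)) : ℝ) ≤ ((126 * 2 ^ 18 : ℤ) : ℝ) := by exact_mod_cast hS
    push_cast at h'
    linarith
  have hW : ∑ x, |W (fun y => signOf (g y)) x| = (2 : ℝ) ^ 6 * ∑ x, |(u x : ℝ)| := by
    rw [mul_sum]
    exact sum_congr rfl fun x _ => by rw [hu x, abs_mul, abs_of_pos (by positivity)]
  rw [hW]
  norm_num
  linarith

end Eighteen

end Summit.QuantumAdvantage.QuantumAdvantage.Theorems.CubicForrelation.NearExactIsExact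

end
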